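import Summits.BirchSwinnertonDyer.BirchSwinnertonDyer.Theorems.Rank2ObservatoryRank3IsoRows000
import Summits.BirchSwinnertonDyer.BirchSwinnertonDyer.Theorems.Rank2ObservatoryRank3IsoRows001
import Summits.BirchSwinnertonDyer.BirchSwinnertonDyer.Theorems.Rank2ObservatoryRank3IsoRows002
import Summits.BirchSwinnertonDyer.BirchSwinnertonDyer.Theorems.Rank2ObservatoryRank3IsoRows003
import HarnessLib

/-!
# BirchSwinnertonDyer — rank ≥ 2 observatory: rank-3 KERNEL-ISO census (`966` curves, `rank_ℤ = 3` unconditional)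

HONEST FRAMING: per-curve certified theorems and census instruments; no claim on BSD in rank ≥ 2.

Assembly of the 4 rank-3 KERNEL-ISO data chunks (`Rank2ObservatoryRank3IsoRowsNNN.lean`): the table
`rank3IsoRows` of the `966` curves of the rank-3 census `rank3Table` (`9487` curves of rank `3`, `N < 500 000`)
whose `2`-division cubic has exactly one integer root (rational `2`-torsion `ℤ/2`: `959`, `ℤ/4`: `7`), each with a
kernel-checked descent-via-`2`-isogeny certificate (`IsoRow.check3`), hence **`rank_ℤ E(ℚ) = 3` UNCONDITIONALLY for
all `966`** (`rank3IsoRows_rank`).  ONE kernel JOIN test against the census (`List.isSublist` of the model keys, `rank3IsoRows_isSublist`)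
certifies that every listed model IS a census model (`rank3IsoRows_census`), and the census-row form
`r_an = rank_ℤ = 3` follows for these rows from Gross–Zagier–Kolyvagin in analytic rank `≤ 1`, the numerical input
`L‴(E,1) ≠ 0` and the two named root-number facts only (`Rank3Row.analyticRank_eq_rank_of_aKey_mem`; the
root number `w = −1` and the rank bounds are kernel facts).  Together with the `20` full-`2`-torsion rows
(`Rank2Observatory<label>RankThree.lean`, complete `2`-descent) this makes `986` of the `9487` rank-3 census
curves with kernel-certified rank; the remaining `8501` have no rational `2`-torsion (out of reach of the tree's
descent frames).  Selmer-size histogram `(#S^(φ), #S^(φ̂))` over the `966`: `(2,16)` 112 · `(4,8)` 398 · `(8,4)` 364 ·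
`(16,2)` 92 (all sharp: `Ш(E₁)[φ] = Ш(E₂)[φ̂] = 0` is forced).

References: J. H. Silverman, J. Tate, *Rational Points on Elliptic Curves* (2nd ed. 2015), §3.6;
J. E. Cremona, *Algorithms for Modular Elliptic Curves* (2nd ed. 1997), §2.13, §3.6 and tables;
H. Darmon, *Rational Points on Modular Elliptic Curves* (2004), Thm. 3.22.
-/

-- single-conjunct summit: `Summit.BirchSwinnertonDyer.BirchSwinnertonDyer.…` repeats the name by design
set_option linter.dupNamespace false

namespace Summit.BirchSwinnertonDyer.BirchSwinnertonDyer.Rank2Observatory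

open WeierstrassCurve Literature Literature.NumberTheory.EllipticCurves
open Literature.Barriers.BirchSwinnertonDyer.DokchitserDokchitser2011 RootNumber
open IsoLocal

/-- **The rank-3 KERNEL-ISO table**: the 4 data chunks in census order. [cite: CremonaAlgorithms1997, Tables] -/
noncomputable def rank3IsoRows : List IsoRow :=
  rank3IsoRows000 ++ rank3IsoRows001 ++ rank3IsoRows002 ++ rank3IsoRows003

/-- Every row passes `IsoRow.check3` (from the chunk theorems). [cite: SilvermanTate2015, §3.6] -/
theorem rank3IsoRows_check : rank3IsoRows.all IsoRow.check3 = true := by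
  simp only [rank3IsoRows, List.all_append, rank3IsoRows000_check, rank3IsoRows001_check, rank3IsoRows002_check, rank3IsoRows003_check, Bool.and_true]

/-- The table has `966` rows (kernel count). [cite: CremonaAlgorithms1997, Tables] -/
theorem rank3IsoRows_length : rank3IsoRows.length = 966 := by
  decide +kernel

/-- **`rank_ℤ E(ℚ) = 3` unconditionally for every one of the `966` listed models.**
[cite: SilvermanTate2015, §3.6] [cite: CremonaAlgorithms1997, §3.6 (Method 1)] -/
theorem rank3IsoRows_rank : ∀ R ∈ rank3IsoRows, R.curve.mordellWeilRank = 3 :=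
  fun _ hR => IsoRow.mordellWeilRank_eq_three_of_all rank3IsoRows_check hR

/-- Kernel JOIN test: the model keys (a-invariants) of `rank3IsoRows` form a sublist of the model keys of the rank-3
census `rank3Table`, in census order (ONE linear kernel walk over the `9487` census rows). [cite: CremonaAlgorithms1997, Tables] -/
theorem rank3IsoRows_isSublist : ((rank3IsoRows.map IsoRow.aKey).isSublist (rank3Table.map aKey₃)) = true := by
  decide +kernel

/-- **Every listed model is a curve of the rank-3 census** (equal to the model of a row of `rank3Table`).
[cite: CremonaAlgorithms1997, Tables] -/
theorem rank3IsoRows_census : ∀ R ∈ rank3IsoRows, ∃ r ∈ rank3Table, r.curve = R.curve :=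
  curve_mem_of_isSublist₃ rank3IsoRows_isSublist

/-- **Census-row rank theorem**: a rank-3 census row whose model occurs in the table has `rank_ℤ = 3`,
unconditionally (instantiate `h` by `decide`). [cite: SilvermanTate2015, §3.6] -/
theorem Rank3Row.mordellWeilRank_eq_three_of_aKey_mem {r : Rank3Row} (h : aKey₃ r ∈ rank3IsoRows.map IsoRow.aKey) :
    r.curve.mordellWeilRank = 3 :=
  census₃_rank_of_aKey_mem rank3IsoRows_check h

/-- **Census-row form `r_an = rank_ℤ = 3`** for a row of `rank3Table` whose model occurs in the table: remaining
hypotheses Gross–Zagier–Kolyvagin in analytic rank `≤ 1`, `L‴(E,1) ≠ 0`, and the two named root-number facts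
(`w = −1` and both rank bounds are kernel facts). [cite: Darmon2004, Thm. 3.22] [cite: CremonaAlgorithms1997, §2.13] -/
theorem Rank3Row.analyticRank_eq_rank_of_aKey_mem {r : Rank3Row} (hr : r ∈ rank3Table)
    (h : aKey₃ r ∈ rank3IsoRows.map IsoRow.aKey) (hGZK : rank_eq_analyticRank_of_analyticRank_le_one)
    (hL3 : iteratedDeriv 3 r.curve.entireLFunction 1 ≠ 0)
    (hKD : r.curve.rootNumber_eq_neg_finprod_tableLocalRootNumberAt')
    (hR : r.curve.rootNumber_eq_neg_finprod_fullTableLocalRootNumberAt) :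
    r.curve.analyticRank = r.curve.mordellWeilRank ∧ r.curve.analyticRank = 3 :=
  census₃_analyticRank_eq_rank rank3IsoRows_check hr h hGZK hL3 hKD hR

end Summit.BirchSwinnertonDyer.BirchSwinnertonDyer.Rank2Observatory
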